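import Mathlib
import HarnessLib
import Literature.NumberTheory.Transcendental.MultipleZetaThreeOneProofs
import Summits.KontsevichZagierPeriods.KontsevichZagierPeriods.Theorems.FurushoPentagonKernelModuloPeriodConjectureEvenDepthOneLeaf

/-!
# `KernelModuloPeriodConjecture`, line `Sketch`: the Zagier–Broadhurst family `ζ(3,1,…,3,1)` for associators

Crux `FurushoPentagon.KernelModuloPeriodConjecture` (stmt-KontsevichZagierPeriods-15058), line
`Sketch`, registered stub `stub_threeOneLeaf` (skeleton v9, lead c3): for every `n` ONE rational
`r_n` with

  `c_{binaryWord {3,1}ⁿ}(φ) = r_n · c_{binaryWord {2}^{2n}}(φ)`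

at every group-like solution `φ` of Drinfeld's pentagon equation over every commutative `ℚ`-algebra
— the Borwein–Bradley–Broadhurst–Lisoněk evaluation `ζ({3,1}ⁿ) = 2π⁴ⁿ/(4n+2)!` (Zagier's
conjecture) FOR ASSOCIATORS, in one-term Hoffman form (`{2}^{2n}` is a Hoffman index of the same
weight `4n`).

## Proof ([BBBL1998, §6] with the analysis replaced by the power forms)

* the shuffle-algebra identity `Σ_{q=0}^{2n} (-1)^q (AB)^{2n-q} ш (AB)^q = (-4)ⁿ (A²B²)ⁿ`
  ([BBBL1998, §4 Cor. 1]; hypothesis 1 of the stub, over any commutative ring — registered stub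
  `stub_shuffleTwosAlternating`) evaluated at the group-like `φ` (`c_u c_v = Σ_{w ∈ u ш v} c_w`):
  `(-4)ⁿ c_{({3,1}ⁿ)} = Σ_q (-1)^q c_{({2}^{2n-q})} c_{({2}^q)}`;
* the power forms `π_Y(φ)({2}ʲ) = q_j c_{(2)}ʲ` (hypothesis 2 at `c = 1` — registered stub
  `stub_powerFormReplicate`; Newton's identities + Euler's theorem for associators), with
  `c_{({2}ʲ)} = (-1)ʲ π_Y(φ)({2}ʲ)`: the right-hand side is `S · c_{(2)}^{2n}`,
  `S = Σ_q (-1)^q q_{2n-q} q_q ∈ ℚ`;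
* `q_{2n} ≠ 0` (`evenLeaf_q_ne_zero`: evaluation at `Φ_KZ`, `ζ({2}ᵏ) = π^{2k}/(2k+1)! ≠ 0`), so
  `c_{(2)}^{2n} = q_{2n}⁻¹ c_{({2}^{2n})}` and `r_n = (-4)⁻ⁿ S q_{2n}⁻¹`.

References: J. M. Borwein, D. M. Bradley, D. J. Broadhurst, P. Lisoněk, Electron. J. Combin. 5 (1998)
R38, §4 Cor. 1, §6 Thm 1 [BBBL1998]; M. E. Hoffman, Pacific J. Math. 152 (1992) Thm 2.2
[Hoffman1992]; H. Furusho, Ann. of Math. 174 (2011) Thm 1.2 [Furusho2011].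
-/

noncomputable section

namespace Summit.KontsevichZagierPeriods.FurushoPentagon.KernelModuloPeriodConjecture

open Literature.NumberTheory.Transcendental
open Finset

/-- The coefficient of the Hoffman word `{2}ʲ = (AB)ʲ` is `(-1)ʲ π_Y(φ)({2}ʲ)`. [cite: Furusho2011, §2] -/
theorem threeOne_apply_twos {R : Type} [CommRing R] (φ : NCSeries Bool R) (j : ℕ) :
    φ (MZV.binaryWord (List.replicate j 2)) = (-1 : R) ^ j * NCSeries.piY φ (List.replicate j 2) := by
  rw [NCSeries.piY_apply_of_forall_pos φ (s := List.replicate j 2)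
    (fun i hi => by rw [List.eq_of_mem_replicate hi]; omega), List.length_replicate, ← mul_assoc,
    ← pow_add, ← two_mul, pow_mul]
  simp

/-- **The Zagier–Broadhurst family for associators** (registered stub `stub_threeOneLeaf` of line
`Sketch`, skeleton v9): from the alternating shuffle identity over any commutative ring and the
power forms `π_Y(φ)({2c}ʲ) = q_j c_{(2)}^{cj}`, for every `n` ONE rational `r` with
`c_{({3,1}ⁿ)}(φ) = r · c_{({2}^{2n})}(φ)` at every group-like pentagon solution over every commutative
`ℚ`-algebra (at `Φ_KZ`: `ζ(3,1,…,3,1) = 2π⁴ⁿ/(4n+2)! = [2(4n+1)!/(4n+2)!]·… ζ(2,…,2)`).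
[cite: BBBL1998, §6 Theorem 1] -/
theorem stub_threeOneLeaf :
    (∀ (R : Type) [CommRing R] (f : List Bool → R) (n : ℕ),
      ∑ q ∈ Finset.range (2 * n + 1), (-1 : R) ^ q *
          ((MZV.shuffleWord (MZV.binaryWord (List.replicate (2 * n - q) 2))
            (MZV.binaryWord (List.replicate q 2))).map f).sum =
        (-4 : R) ^ n * f (MZV.binaryWord (List.replicate n [3, 1]).flatten)) →
    (∀ c : ℕ, 1 ≤ c → ∀ N : ℕ, ∃ q : ℕ → ℚ, ∀ j : ℕ, j ≤ N →
      ∀ (R : Type) [CommRing R] [Algebra ℚ R] (φ : NCSeries Bool R),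
        NCSeries.IsGroupLike φ → NCSeries.DrinfeldPentagon φ →
          NCSeries.piY φ (List.replicate j (2 * c)) =
            algebraMap ℚ R (q j) * φ (MZV.binaryWord [2]) ^ (c * j)) →
    ∀ n : ℕ, ∃ r : ℚ, ∀ (R : Type) [CommRing R] [Algebra ℚ R] (φ : NCSeries Bool R),
      NCSeries.IsGroupLike φ → NCSeries.DrinfeldPentagon φ →
        φ (MZV.binaryWord (List.replicate n [3, 1]).flatten) =
          r • φ (MZV.binaryWord (List.replicate (2 * n) 2)) := by
  intro hB hPF n
  obtain ⟨q, hq⟩ := hPF 1 le_rfl (2 * n)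
  -- the power forms for the letter `2` (hypothesis 2 at `c = 1`)
  have hq' : ∀ j : ℕ, j ≤ 2 * n → ∀ (R : Type) [CommRing R] [Algebra ℚ R] (φ : NCSeries Bool R),
      NCSeries.IsGroupLike φ → NCSeries.DrinfeldPentagon φ →
        NCSeries.piY φ (List.replicate j 2) = algebraMap ℚ R (q j) * φ (MZV.binaryWord [2]) ^ j := by
    intro j hj R _ _ φ hg h5
    simpa only [Nat.mul_one, Nat.one_mul] using hq j hj R φ hg h5
  have hqnz : q (2 * n) ≠ 0 :=
    evenLeaf_q_ne_zero fun R _ _ φ hg h5 => hq' (2 * n) le_rfl R φ hg h5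
  refine ⟨((-4 : ℚ) ^ n)⁻¹ * ((∑ k ∈ range (2 * n + 1), (-1 : ℚ) ^ k * q (2 * n - k) * q k) *
    (q (2 * n))⁻¹), fun R _ _ φ hg h5 => ?_⟩
  set c₂ : R := φ (MZV.binaryWord [2]) with hc₂
  have hwordq : ∀ j, j ≤ 2 * n → φ (MZV.binaryWord (List.replicate j 2)) =
      (-1 : R) ^ j * (algebraMap ℚ R (q j) * c₂ ^ j) := fun j hj => by
    rw [threeOne_apply_twos φ j, hq' j hj R φ hg h5]
  -- [BBBL1998, Cor. 1] at the group-like `φ`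
  have hBφ := hB R φ n
  have hterm : ∀ k ∈ range (2 * n + 1), (-1 : R) ^ k *
      ((MZV.shuffleWord (MZV.binaryWord (List.replicate (2 * n - k) 2))
        (MZV.binaryWord (List.replicate k 2))).map φ).sum =
      algebraMap ℚ R ((-1 : ℚ) ^ k * q (2 * n - k) * q k) * c₂ ^ (2 * n) := by
    intro k hk
    rw [mem_range] at hk
    rw [← hg.mul_eq_sum_shuffleWord, hwordq (2 * n - k) (by omega), hwordq k (by omega), map_mul,
      map_mul, map_pow, map_neg, map_one]
    have hs : (-1 : R) ^ (2 * n - k) * (-1) ^ k = 1 := by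
      rw [← pow_add, show 2 * n - k + k = 2 * n by omega, pow_mul]
      simp
    have hc : c₂ ^ (2 * n - k) * c₂ ^ k = c₂ ^ (2 * n) := by
      rw [← pow_add, show 2 * n - k + k = 2 * n by omega]
    linear_combination
      ((-1 : R) ^ k * algebraMap ℚ R (q (2 * n - k)) * algebraMap ℚ R (q k) *
          ((-1 : R) ^ (2 * n - k) * (-1) ^ k)) * hc +
        ((-1 : R) ^ k * algebraMap ℚ R (q (2 * n - k)) * algebraMap ℚ R (q k) * c₂ ^ (2 * n)) * hs
  rw [Finset.sum_congr rfl hterm, ← Finset.sum_mul, ← map_sum,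
    show (-4 : R) ^ n = algebraMap ℚ R ((-4 : ℚ) ^ n) by
      rw [map_pow, map_neg, map_ofNat]] at hBφ
  have hx := evenLeaf_eq_inv_mul (d := (-4 : ℚ) ^ n) (pow_ne_zero _ (by norm_num)) hBφ.symm
  -- `c₂^{2n}` in terms of the Hoffman word `{2}^{2n}`
  have h2n : algebraMap ℚ R (q (2 * n)) * c₂ ^ (2 * n) =
      φ (MZV.binaryWord (List.replicate (2 * n) 2)) := by
    rw [hwordq (2 * n) le_rfl, pow_mul]
    simp
  have hcc := evenLeaf_eq_inv_mul hqnz h2n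
  rw [hx, hcc, Algebra.smul_def, map_mul, map_mul]
  ring

end Summit.KontsevichZagierPeriods.FurushoPentagon.KernelModuloPeriodConjecture

end
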